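import Literature.NumberTheory.GaloisRepresentations.HOneUnramifiedProcyclic
import Literature.NumberTheory.GaloisRepresentations.HOneRestrictionOntoInvariantsFinite
import Literature.NumberTheory.GaloisRepresentations.LocalGaloisGroupFrobeniusProofs
import Literature.NumberTheory.GaloisRepresentations.ContinuousH1RestrictScalars
import Literature.NumberTheory.EllipticCurves.BigGaloisRepSelmer
import Literature.NumberTheory.IwasawaTheory.Greenberg2016.SelmerGroupStructure
import Literature.NumberTheory.Automorphic.AdicCompletionLocalField
import HarnessLib

/-!
# Crux 4 `BSDpOnCellC` (stmt-BirchSwinnertonDyer-19034), line «telescope», workfile `Lines/telescopeK2weight2.lean` v1.2,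
# sub-leaf W4⁰ (`K2Weight2.stub_bigPseudoNullPTorsion`), route G′ model fact (M3):
# **`𝐃^{I_w} ↠ H¹_ur(K_w, 𝐃) = ker(H¹(K_w, 𝐃) → H¹(I_w, 𝐃))` for DISCRETE TORSION coefficients**
# (ideator seat `bsd-idea-12` gen 39; `--supports stmt-BirchSwinnertonDyer-19034 --as helper`; THEOREMS ONLY; closes nothing)

HONEST FRAMING. No registered stub, no crux, no summit statement is proved here; BSD is proved for no curve.
This is the brick (M3) of the ideator's route G′ for W4⁰ (memo `Cruxes/BSDpOnCellC/W-PRICING-n2.md` §W4-G′): the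
`Λ`-linear SURJECTION from the inertia invariants `𝐃^{I_w}` onto the unramified local condition
`L_w = ker(H¹(K_w, 𝐃) → H¹(I_w, 𝐃))` (the `Sum.inr w` entry of `TelescopeK2SelmerDictionary.specOfIndexSet`, p747353),
for ANY discrete continuous representation `τ : Γ_{K_w} → Aut_Λ(D)` on a TORSION abelian group `D` — e.g.
`𝐃 = BigRepModule`, which is `p`-primary with INFINITE `p^k`-torsion, so that neither the tree's profinite-tower form
(`LocalHOneInertiaRestrictionProfinite.exists_vanishing_apply_eq_absInertia_of_tower`, finite levels) nor its finite form
(`HOneRestrictionOntoInvariantsFinite`) nor the `p`-primary-with-finite-layers form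
(`ThetaPartnerAtTwoSignedTransportAtTwoLocalFactorTools.exists_contOneCocycles_apply_eq_of_primary`) applies as typed.
Composed with helper #4 (`TelescopeK2BigRepInertiaInvariants.exists_isAlmostDivisible_map_lsmul_pow_of_inertia`) it
yields route G′'s input (ii′) «`p^a · L_w` is almost `B`-divisible» at every `w ∤ p`.

* §1 **(KM4) for torsion discrete coefficients** `exists_contOneCocycles_apply_eq_of_isOfFinAddOrder`: `G` compact totally
  disconnected, `C ≤ G` closed, topologically generated by `ψ`, with an open subgroup of every positive index; every `t ∈ M`
  of finite additive order is `y(ψ)` for a continuous cocycle `y` of `C` — the tree's finite case run inside the FINITE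
  `G`-stable subgroup `ℤ·(G·t)` (finite orbit: compact group, discrete module; finitely generated and killed by `ord t`).
* §2 **unramified cocycles with prescribed Frobenius value** `exists_vanishing_absInertia_apply_eq_of_isOfFinAddOrder`:
  `F` non-archimedean local, `τ : Γ_F → Aut_R(D)` discrete, `φ` an arithmetic Frobenius lift, `t ∈ D^{I_F}` of finite order
  ⇒ a continuous cocycle `z` of `Γ_F` VANISHING on `I_F` with `z(φ) = t` (tree: `exists_vanishing_apply_eq_of_isFreeProcyclic`
  over `ℤ`, transported back by `ContinuousRep.ofIntCocycle`).
* §3 **the surjection** `exists_linearMap_surjective_invariants_ker_Hpullback`: for `D` torsion, along any spelling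
  `ι : I_F → Γ_F` of the inclusion, `∃ π : D^{I_F} →ₗ[R] ker(H¹(Γ_F, D) → H¹(I_F, D))` onto (`t ↦ [z_t]`; linear because two
  `I_F`-vanishing cocycles with the same value at `φ` are cohomologous, `oneCocycleClass_eq_iff_of_vanishing_of_dense`; onto
  because a class dying on `I_F` has an `I_F`-vanishing representative whose value at `φ` is `I_F`-invariant).
* §4 **number-field spelling** `exists_linearMap_surjective_invariants_ker_Hpullback_inertiaIncl`: `F = K_w = w.adicCompletion K`,
  `ι = BigGaloisRep.inertiaIncl K w` — the shape of (M4); and the Greenberg-arena form for `Greenberg2016.localRep S ρ (Sum.inr w)`.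

References: J.-P. Serre, Local Fields (1979), XIII §1 Prop. 1 [SerreLocalFields1979]; K. Rubin, Euler Systems (2000),
Lemma 1.3.2 and Prop. B.2.5 [Rubin2000]; R. Greenberg, in LNM 1716 (1999), §2–§3 (the unramified local condition for
`E[p^∞]` and `Λ`-adic coefficients) [Greenberg1999LNM]; R. Greenberg, On the structure of Selmer groups (2016), §1 p. 3 and
§4.1 [Greenberg2016Selmer].
-/

set_option linter.dupNamespace false
set_option autoImplicit false

noncomputable section

open CategoryTheory Function Topology
open Field IsDedekindDomain NumberField
open Literature.GroupTheory
open Literature.NumberTheory.GaloisRepresentations Literature.NumberTheory.GaloisRepresentations.IsNonarchimedeanLocalField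
open Literature.NumberTheory.EllipticCurves Literature.NumberTheory.EllipticCurves.BigGaloisRep
open Literature.NumberTheory.IwasawaTheory
open scoped NumberField

universe u

namespace Summit.BirchSwinnertonDyer.BirchSwinnertonDyer.Theorems.TelescopeK2HOneUnramifiedOfInvariants

/-! ## §0. Torsion -/

section Torsion

variable {D : Type u} [AddCommGroup D]

/-- **`p`-primary modules are torsion** (the form in which W4⁰'s `𝐃 = BigRepModule` meets `htors`: every element is killed by
a power of `p`). [folklore] -/
theorem isOfFinAddOrder_of_pow_smul_eq_zero {p : ℕ} (hp : p.Prime) {d : D} (h : ∃ k : ℕ, p ^ k • d = 0) :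
    IsOfFinAddOrder d := by
  obtain ⟨k, hk⟩ := h
  exact isOfFinAddOrder_iff_nsmul_eq_zero.2 ⟨p ^ k, pow_pos hp.pos k, hk⟩

end Torsion

/-! ## §1. (KM4) for torsion discrete coefficients -/

section KM4

variable {G : Type u} [Group G] [TopologicalSpace G] [IsTopologicalGroup G] [CompactSpace G]
  [TotallyDisconnectedSpace G]
variable {M : Type u} [AddCommGroup M] [TopologicalSpace M] [DiscreteTopology M]

/-- **(KM4) for TORSION discrete coefficients.** `G` compact totally disconnected, `C ≤ G` closed, topologically
generated by `ψ` and with an open subgroup of every positive index (`C ≅ Ẑ`), `τ : G → Aut(M)` a discrete continuous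
representation: every `t ∈ M` of finite additive order is the value at `ψ` of a continuous cocycle of `C` — the tree's
finite case `exists_contOneCocycles_apply_eq_of_finite` inside the finite `G`-stable subgroup `ℤ·(G·t)` (the orbit `G·t`
is finite, being compact and discrete; the span is finitely generated and killed by the order of `t`), pushed forward
along `ℤ·(G·t) ↪ M`. [cite: SerreLocalFields1979, XIII §1 Prop. 1] [cite: Rubin2000, Prop. B.2.5] -/
theorem exists_contOneCocycles_apply_eq_of_isOfFinAddOrder (τ : ContinuousRep G ℤ M) (C : Subgroup G)
    (hC : IsClosed (C : Set G)) {ψ : C} (hdense : Dense (Subgroup.zpowers ψ : Set C))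
    (hidx : ∀ n : ℕ, 0 < n → ∃ H : Subgroup C, IsOpen (H : Set C) ∧ H.index = n)
    (t : M) (ht : IsOfFinAddOrder t) :
    ∃ y : contOneCocycles (subgroupRep τ.toTopRep C), y.1 ψ = t := by
  classical
  -- the orbit `G·t` is finite
  have hO : (Set.range fun g : G => τ g t).Finite :=
    (isCompact_range (τ.continuous_apply_left t)).finite_of_discrete
  -- the `G`-stable subgroup `B = ℤ·(G·t) ∋ t`
  let B : Submodule ℤ M := Submodule.span ℤ (Set.range fun g : G => τ g t)
  have htB : t ∈ B := Submodule.subset_span ⟨1, by change τ 1 t = t; rw [map_one]; rfl⟩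
  have hstab : ∀ (g : G) (m : M), m ∈ B → τ g m ∈ B := by
    intro g m hm
    have hle : Submodule.map (τ g) B ≤ B := by
      refine (Submodule.map_span_le (τ g) _ B).2 ?_
      rintro _ ⟨h, rfl⟩
      exact Submodule.subset_span ⟨g * h, by change τ (g * h) t = τ g (τ h t); rw [map_mul]; rfl⟩
    exact hle (Submodule.mem_map_of_mem hm)
  -- `B` is killed by the order of `t`, hence finite
  have hn : 0 < addOrderOf t := ht.addOrderOf_pos
  have hkill : ∀ m ∈ B, addOrderOf t • m = 0 := by
    intro m hm
    refine Submodule.span_induction (p := fun m _ => addOrderOf t • m = 0) ?_ ?_ ?_ ?_ hm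
    · rintro _ ⟨g, rfl⟩
      change addOrderOf t • τ g t = 0
      rw [← map_nsmul, addOrderOf_nsmul_eq_zero, map_zero]
    · exact smul_zero _
    · intro x y _ _ hx hy
      rw [smul_add, hx, hy, add_zero]
    · intro a x _ hx
      rw [smul_comm, hx, smul_zero]
  haveI : Module.Finite ℤ B := Module.Finite.span_of_finite ℤ hO
  have hBtors : Module.IsTorsion ℤ B := fun x =>
    ⟨⟨(addOrderOf t : ℤ), mem_nonZeroDivisors_of_ne_zero (Int.natCast_ne_zero.mpr hn.ne')⟩,
      Subtype.ext (by
        change (addOrderOf t : ℤ) • (x : M) = 0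
        rw [natCast_zsmul]
        exact hkill x x.2)⟩
  haveI : Finite B := Module.finite_of_fg_torsion B hBtors
  -- the finite sub-representation
  let ρB : Representation ℤ G B :=
    { toFun := fun g => (τ g).restrict (hstab g)
      map_one' := by ext b; simp
      map_mul' := fun g h => by ext b; simp }
  let τB : ContinuousRep G ℤ B :=
    { toRepresentation := ρB
      continuous_smul := by
        refine Continuous.subtype_mk ?_ _
        exact τ.continuous_smul.comp (continuous_fst.prodMk (continuous_subtype_val.comp continuous_snd)) }
  obtain ⟨yB, hyB⟩ := exists_contOneCocycles_apply_eq_of_finite τB C hC hdense hidx ⟨t, htB⟩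
  have hval : ∀ (g : C) (b : B), (((subgroupRep τB.toTopRep C).ρ g b : B) : M) = τ (g : G) (b : M) :=
    fun _ _ => rfl
  refine ⟨⟨(⟨Subtype.val, continuous_subtype_val⟩ : C(B, M)).comp yB.1, fun g h => ?_⟩, ?_⟩
  · have e := congrArg Subtype.val (yB.2 g h)
    rw [Submodule.coe_add, hval] at e
    exact e
  · change ((yB.1 ψ : B) : M) = t
    rw [hyB]

end KM4

/-! ## §2. Unramified cocycles of a local Galois group with prescribed Frobenius value (torsion discrete coefficients) -/

section Local

variable (F : Type u) [Field F] [ValuativeRel F] [TopologicalSpace F] [IsNonarchimedeanLocalField F]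
variable {R : Type u} [CommRing R] [TopologicalSpace R]
variable {D : Type u} [AddCommGroup D] [Module R D] [TopologicalSpace D] [DiscreteTopology D]
  [ContinuousSMul R D]

/-- **`D^{I_F} → H¹_ur(F, D)`, cocycle level, for TORSION discrete `D`.** For a non-archimedean local field `F`, an
arithmetic Frobenius lift `φ ∈ Γ_F` and a discrete continuous `τ : Γ_F → Aut_R(D)`: every `I_F`-invariant `t ∈ D` of
finite additive order is the value at `φ` of a continuous cocycle of `Γ_F` VANISHING on `I_F = absInertia F` (its class is
unramified). The tree's `exists_vanishing_apply_eq_of_isFreeProcyclic` (over `ℤ`: `Γ_F ⧸ I_F` free procyclic on `φ`,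
retraction `Γ_F → cl⟨φ⟩`) fed with §1's (KM4), transported back to `R`-cocycles by `ContinuousRep.ofIntCocycle` (same
function). [cite: SerreLocalFields1979, XIII §1 Prop. 1] [cite: Rubin2000, Lemma 1.3.2] -/
theorem exists_vanishing_absInertia_apply_eq_of_isOfFinAddOrder (τ : ContinuousRep (absoluteGaloisGroup F) R D)
    {φ : absoluteGaloisGroup F} (hφ : IsFrobPow φ 1) {t : D} (htors : IsOfFinAddOrder t)
    (ht : ∀ n : absInertia F, τ (n : absoluteGaloisGroup F) t = t) :
    ∃ z : contOneCocycles τ.toTopRep, (∀ n : absInertia F, z.1 n = 0) ∧ z.1 φ = t := by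
  haveI := absoluteGaloisGroup_compactSpace F
  haveI : (absInertia F).Normal := absInertia_normal_holds F
  have hφd := dense_zpowers_mk_absInertia_of_isFrobPow F hφ
  obtain ⟨z, hz, hzφ⟩ := exists_vanishing_apply_eq_of_isFreeProcyclic τ.toIntRep.toTopRep (absInertia F)
    (isClosed_absInertia_holds F) (isFreeProcyclic_quotient_absInertia' F) φ hφd (t := t) (fun n => ht n)
    (exists_contOneCocycles_apply_eq_of_isOfFinAddOrder τ.toIntRep _ (Subgroup.isClosed_topologicalClosure _)
      (dense_zpowers_mk_topologicalClosure' φ)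
      (exists_isOpen_index_topologicalClosure_zpowers (absInertia F) (isClosed_absInertia_holds F)
        (isFreeProcyclic_quotient_absInertia' F) φ hφd) t htors)
  exact ⟨τ.ofIntCocycle z, hz, hzφ⟩

/-- **Membership in `ker(H¹(Γ_F, D) → H¹(I_F, D))` on cocycles**: along any spelling `ι` of the inclusion `I_F ↪ Γ_F`, the
class of a cocycle `c` of `Γ_F` dies under `Hpullback ι` iff `c|_{I_F}` is a coboundary `n ↦ n·v − v`.
[cite: SerreGaloisCohomology1997, I §2.4] -/
theorem Hpullback_oneCocycleClass_eq_zero_iff (τ : ContinuousRep (absoluteGaloisGroup F) R D)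
    (ι : ↥(absInertia F) →ₜ* absoluteGaloisGroup F) (hι : ∀ n : absInertia F, ι n = (n : absoluteGaloisGroup F))
    (c : contOneCocycles τ.toTopRep) :
    τ.Hpullback ι 1 (oneCocycleClass _ c) = 0 ↔
      ∃ v : D, ∀ n : absInertia F, c.1 n = τ (n : absoluteGaloisGroup F) v - v := by
  change ContinuousCohomology.map ι (resMod τ ι) 1 (oneCocycleClass _ c) = 0 ↔ _
  rw [map_oneCocycleClass, oneCocycleClass_eq_zero_iff]
  refine exists_congr fun v => forall_congr' fun n => ?_
  rw [contOneCocycles.pullback_apply, resMod_hom_apply, hι]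
  change c.1 (n : absoluteGaloisGroup F) = τ (ι n) v - v ↔ _
  rw [hι]

/-- **(M3) THE SURJECTION `D^{I_F} ↠ H¹_ur(F, D) = ker(H¹(Γ_F, D) → H¹(I_F, D))` for TORSION discrete `D`.** For a
non-archimedean local field `F`, a discrete continuous `τ : Γ_F → Aut_R(D)` on a torsion abelian group `D` and any
spelling `ι` of `I_F ↪ Γ_F`: there is an `R`-LINEAR SURJECTION from the `I_F`-invariants of `D` (invariants of `τ.restrict ι`)
onto `ker (τ.Hpullback ι 1)`. It is `t ↦ [z_t]` (`z_t` from `exists_vanishing_absInertia_apply_eq_of_isOfFinAddOrder` at a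
fixed Frobenius lift `φ`): well defined and linear because two `I_F`-vanishing cocycles with the same value at `φ` are
cohomologous (`oneCocycleClass_eq_iff_of_vanishing_of_dense`, `I_F·⟨φ⟩` dense); onto because a class dying on `I_F` has an
`I_F`-vanishing representative (`Hpullback_oneCocycleClass_eq_zero_iff` + a coboundary) whose value at `φ` is
`I_F`-invariant (`apply_mem_invariants_of_vanishing`). Kernel (not needed here): `(φ − 1)D^{I_F}`.
[cite: SerreLocalFields1979, XIII §1 Prop. 1] [cite: Rubin2000, Lemma 1.3.2] [cite: Greenberg1999LNM, §2]
[cite: Greenberg2016Selmer, §1 p. 3 L19–25] -/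
theorem exists_linearMap_surjective_invariants_ker_Hpullback (τ : ContinuousRep (absoluteGaloisGroup F) R D)
    (htors : ∀ d : D, IsOfFinAddOrder d)
    (ι : ↥(absInertia F) →ₜ* absoluteGaloisGroup F) (hι : ∀ n : absInertia F, ι n = (n : absoluteGaloisGroup F)) :
    ∃ π : (τ.restrict ι).toTopRep.ρ.invariants →ₗ[R] LinearMap.ker (τ.Hpullback ι 1), Function.Surjective π := by
  classical
  haveI := absoluteGaloisGroup_compactSpace F
  haveI : (absInertia F).Normal := absInertia_normal_holds F
  obtain ⟨φ, hφa⟩ := exists_isAbsArithFrob_holds F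
  have hφ : IsFrobPow φ 1 := IsAbsArithFrob.isFrobPow_holds hφa
  have hφd := dense_zpowers_mk_absInertia_of_isFrobPow F hφ
  -- membership in the invariants `V = D^{I_F}`
  have hV : ∀ t : D, t ∈ (τ.restrict ι).toTopRep.ρ.invariants ↔
      ∀ n : absInertia F, τ (n : absoluteGaloisGroup F) t = t := fun t =>
    ⟨fun h n => by rw [← hι n]; exact h n, fun h n => show τ (ι n) t = t by rw [hι]; exact h n⟩
  -- classes of `I_F`-vanishing cocycles lie in `U`
  have hU : ∀ c : contOneCocycles τ.toTopRep, (∀ n : absInertia F, c.1 n = 0) →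
      oneCocycleClass _ c ∈ LinearMap.ker (τ.Hpullback ι 1) := by
    intro c hc
    change τ.Hpullback ι 1 (oneCocycleClass _ c) = 0
    rw [Hpullback_oneCocycleClass_eq_zero_iff F τ ι hι]
    exact ⟨0, fun n => by rw [hc, map_zero, sub_zero]⟩
  -- two `I_F`-vanishing cocycles with the same value at `φ` are cohomologous
  have hcls : ∀ c c' : contOneCocycles τ.toTopRep, (∀ n : absInertia F, c.1 n = 0) →
      (∀ n : absInertia F, c'.1 n = 0) → c.1 φ = c'.1 φ → oneCocycleClass _ c = oneCocycleClass _ c' := by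
    intro c c' hc hc' h
    exact (oneCocycleClass_eq_iff_of_vanishing_of_dense τ.toTopRep τ.continuous_smul (absInertia F) φ hφd c c'
      hc hc').2 ⟨0, fun n => map_zero _, by rw [h, sub_self, map_zero, sub_zero]⟩
  -- the cocycles `z_t`
  have hex : ∀ t : (τ.restrict ι).toTopRep.ρ.invariants, ∃ z : contOneCocycles τ.toTopRep,
      (∀ n : absInertia F, z.1 n = 0) ∧ z.1 φ = (t : D) := fun t =>
    exists_vanishing_absInertia_apply_eq_of_isOfFinAddOrder F τ hφ (htors _) ((hV _).1 t.2)
  choose z hz hzφ using hex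
  -- the map
  let π : (τ.restrict ι).toTopRep.ρ.invariants →ₗ[R] LinearMap.ker (τ.Hpullback ι 1) :=
    { toFun := fun t => ⟨oneCocycleClass _ (z t), hU _ (hz t)⟩
      map_add' := fun s t => by
        apply Subtype.ext
        change oneCocycleClass _ (z (s + t)) = oneCocycleClass _ (z s) + oneCocycleClass _ (z t)
        rw [← oneCocycleClass_add]
        refine hcls _ _ (hz _) (fun n => ?_) ?_
        · change (z s).1 n + (z t).1 n = 0
          rw [hz, hz, add_zero]
        · change (z (s + t)).1 φ = (z s).1 φ + (z t).1 φ
          rw [hzφ, hzφ, hzφ]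
          rfl
      map_smul' := fun r t => by
        apply Subtype.ext
        change oneCocycleClass _ (z (r • t)) = r • oneCocycleClass _ (z t)
        rw [← oneCocycleClass_smul]
        refine hcls _ _ (hz _) (fun n => ?_) ?_
        · change r • (z t).1 n = 0
          rw [hz, smul_zero]
        · change (z (r • t)).1 φ = r • (z t).1 φ
          rw [hzφ, hzφ]
          rfl }
  refine ⟨π, fun c => ?_⟩
  -- onto: an `I_F`-vanishing representative of `c`
  obtain ⟨c₀, hc₀⟩ := oneCocycleClass_surjective τ.toTopRep (c : τ.H 1)
  have hc₀U : τ.Hpullback ι 1 (oneCocycleClass _ c₀) = 0 := by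
    rw [hc₀]; exact c.2
  obtain ⟨v, hv⟩ := (Hpullback_oneCocycleClass_eq_zero_iff F τ ι hι c₀).1 hc₀U
  -- the coboundary of `v`
  let δ : contOneCocycles τ.toTopRep :=
    ⟨⟨fun g => τ g v - v, (τ.continuous_apply_left v).sub continuous_const⟩, fun g h => by
      change τ (g * h) v - v = (τ g v - v) + τ.toTopRep.ρ g (τ h v - v)
      rw [ContinuousRep.toTopRep_ρ_apply, map_sub, map_mul, Module.End.mul_apply]
      abel⟩
  have hδ : oneCocycleClass _ δ = 0 := (oneCocycleClass_eq_zero_iff _ δ).2 ⟨v, fun _ => rfl⟩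
  have hc₁ : ∀ n : absInertia F, (c₀ - δ).1 n = 0 := fun n => by
    change c₀.1 n - (τ (n : absoluteGaloisGroup F) v - v) = 0
    rw [hv n, sub_self]
  -- its value at `φ` is `I_F`-invariant
  have ht : (c₀ - δ).1 φ ∈ (τ.restrict ι).toTopRep.ρ.invariants := (hV _).2 fun n =>
    apply_mem_invariants_of_vanishing τ.toTopRep (c₀ - δ) hc₁ φ n
  refine ⟨⟨_, ht⟩, Subtype.ext ?_⟩
  change oneCocycleClass _ (z ⟨_, ht⟩) = (c : τ.H 1)
  rw [← hc₀, show oneCocycleClass _ c₀ = oneCocycleClass _ (c₀ - δ) by rw [oneCocycleClass_sub, hδ, sub_zero]]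
  exact hcls _ _ (hz _) hc₁ (hzφ _)

end Local

/-! ## §4. Number-field spellings: `F = K_w`, `ι = BigGaloisRep.inertiaIncl K w` -/

section NumberField

variable {K : Type u} [Field K] [NumberField K]
variable {R : Type u} [CommRing R] [TopologicalSpace R]
variable {D : Type u} [AddCommGroup D] [Module R D] [TopologicalSpace D] [DiscreteTopology D]
  [ContinuousSMul R D]

/-- **(M3) at a finite place `w` of a number field**, in the spelling of (M4) (`TelescopeK2SelmerDictionary.specOfIndexSet`,
entry `Sum.inr w`): for a discrete continuous `τ : Γ_{K_w} → Aut_R(D)` on a torsion `D`, an `R`-linear surjection from the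
`I_w`-invariants (`(τ.restrict (inertiaIncl K w)).toTopRep.ρ.invariants`) onto
`ker (τ.Hpullback (BigGaloisRep.inertiaIncl K w) 1) = H¹_ur(K_w, D)`. [cite: Rubin2000, Lemma 1.3.2]
[cite: Greenberg2016Selmer, §1 p. 3 L19–25] -/
theorem exists_linearMap_surjective_invariants_ker_Hpullback_inertiaIncl (w : HeightOneSpectrum (𝓞 K))
    (τ : ContinuousRep (absoluteGaloisGroup (w.adicCompletion K)) R D) (htors : ∀ d : D, IsOfFinAddOrder d) :
    ∃ π : (τ.restrict (BigGaloisRep.inertiaIncl K w)).toTopRep.ρ.invariants →ₗ[R]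
        LinearMap.ker (τ.Hpullback (BigGaloisRep.inertiaIncl K w) 1), Function.Surjective π :=
  exists_linearMap_surjective_invariants_ker_Hpullback (w.adicCompletion K) τ htors (BigGaloisRep.inertiaIncl K w)
    fun _ => rfl

/-- **(M3) in Greenberg's arena** (`𝐃` a discrete torsion `G_{K,Σ}`-representation `ρ`, `K_w`-module structure
`Greenberg2016.localRep S ρ (Sum.inr w)`): an `R`-linear surjection from the `I_w`-invariants onto the unramified local condition
`ker ((localRep S ρ (Sum.inr w)).Hpullback (inertiaIncl K w) 1)` — the `Sum.inr w` entry of `specOfIndexSet S ρ L₀` whenever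
`Sum.inr w ∈ L₀ ∌ Sum.inl w` (p747353). [cite: Greenberg2016Selmer, §1 p. 3 L19–28] [cite: Rubin2000, Lemma 1.3.2] -/
theorem exists_linearMap_surjective_invariants_ker_Hpullback_localRep (S : Set (HeightOneSpectrum (𝓞 K)))
    (ρ : ContinuousRep (GaloisGroupUnramifiedOutside K S) R D) (htors : ∀ d : D, IsOfFinAddOrder d)
    (w : HeightOneSpectrum (𝓞 K)) :
    ∃ π : ((Greenberg2016.localRep S ρ (Sum.inr w)).restrict (BigGaloisRep.inertiaIncl K w)).toTopRep.ρ.invariants →ₗ[R]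
        LinearMap.ker ((Greenberg2016.localRep S ρ (Sum.inr w)).Hpullback (BigGaloisRep.inertiaIncl K w) 1),
      Function.Surjective π :=
  exists_linearMap_surjective_invariants_ker_Hpullback_inertiaIncl w (Greenberg2016.localRep S ρ (Sum.inr w)) htors

end NumberField

end Summit.BirchSwinnertonDyer.BirchSwinnertonDyer.Theorems.TelescopeK2HOneUnramifiedOfInvariants

end
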